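import Mathlib.Algebra.Group.Submonoid.Operations
import Mathlib.Algebra.Group.Pi.Lemmas
import Mathlib.GroupTheory.QuotientGroup.Defs
import Literature.IUT.HodgeArakelov.TemperedThetaMonoidsProofs
import Literature.IUT.HodgeArakelov.GaussianMonoidsGood
import Literature.IUT.HodgeArakelov.LabelClassesOfCusps

/-!
# [IUTchII] Cor 3.5 (i)–(iii), Cor 3.6 (i): symmetrizing isomorphisms, the restriction isomorphism
# `Ψ_env ⥲ Ψ_gau`, the constant diagonal — proof companion no. 2 of `BadPrimeGaussianMonoids.lean`

S. Mochizuki, *Inter-universal Teichmüller theory II*, §3, kurims Dec-2020 manuscript: Cor 3.5 pp. 93–96,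
Cor 3.6 pp. 99–101 [cite: Mochizuki2012, Cor 3.5 p.93]. Claim key DISPUTED (D-0012). PROOF-ONLY companion
(abc-iut cell, layer L6, DISCHARGE-L6 v1.5 §F row F1, seat abc-iut-w4-d004; nodes IUTchII:Cor3.5(i),
IUTchII:Cor3.6(i), plus the restriction clause of IUTchII:Cor3.5(ii) and the diagonal clause of
IUTchII:Cor3.5(iii)). NO definition, NO `Prop` fact: theorems about objects already REAL in the tree — the
`𝔽^±_l`-torsor structure on `LabCusp^±(Π̂^±_v)` with the conjugation action of `Π̂^cor_v` (abc-iut-L6-t1,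
`FlTorsorStructure`, Def 2.3 (v)); the theta monoids `Ψ^ι_env = M^×_TM · θ^ℕ`, `∞Ψ^ι_env`, `Ψ_cns` of Prop 3.1
(abc-iut-L6-t2, abc-iut-L6-d3: `TemperedThetaMonoids.ThetaEnvData`, `splitMonoid`); the Gaussian monoids
`Ψ_ξ`, `∞Ψ_ξ`, `Ψ_{2l·ξ}`, the unit diagonal, `diagonalSubmonoid`, `piIso` (abc-iut-L6-t2). The SLOT-ONLY fields
`symmetrizing`, `restriction`, `frobenioidSymmetrizing` of `Cor35Statements` (instantiable by `True`,
ref-b PASS-8 B7) are replaced by the PROVED statements below.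

* **Cor 3.5 (i)** (labels, `𝔽_l^{⋊±}`-symmetries): from the single axiom `conjAct_chart` we PROVE that the
  conjugation action of `Π̂^cor_v` on `LabCusp^±` is an action (`conjAct_one`, `conjAct_mul`), that `Π̂^±_v`
  acts trivially (`conjAct_eq_self_of_mem_pmHat`: the symmetrizing isomorphisms between labeled copies of
  any object acted on by `Π̂^cor_v` are well-defined up to `Π̂^±_v`, an indeterminacy independent of the
  label), that the action is TRANSITIVE (`exists_conjAct_eq`: symmetrizing isomorphisms exist between the
  data at any two labels), that the stabiliser of `t` modulo `Π̂^±_v` is exactly {identity, reflection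
  `x ↦ -x + 2t`} (`conjAct_eq_self_iff`), and that one element acts by `t ↦ -t` on all labels
  (`exists_conjAct_neg`: the identification of the copies labeled `t`, `-t` into `|t|`).
* **Cor 3.5 (i)/(ii)** (restriction): for restriction morphisms `r_t : H → M` (`t ∈ F_l^⋇`; in print the
  restrictions to `D^δ_{t,μ_-}` of Cor 2.8 (i), (ii)) — if the units `M^×_TM` restrict to DIAGONAL unit
  families (label-independence of constants, "`Ψ_cns ⥲ Ψ_cns,⟨|F_l|⟩`"), the product map `x ↦ (r_t x)_t`
  carries `M^×_TM · θ^ℕ` into the Gaussian monoid `Ψ_ξ` of the value-profile `ξ = (r_t θ)_t`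
  (`map_thetaSplit_le_gaussianMonoid`), onto it when every diagonal unit so arises
  (`map_thetaSplit_eq_gaussianMonoid`), `∞Ψ^ι_env` into `∞Ψ_ξ` (`map_inftySplit_le_inftyGaussianMonoid`), and,
  given injectivity at ONE label (reduced to two kernel conditions, `injOn_thetaSplit_of_ker`), "the lower
  horizontal arrow is an isomorphism of monoids": a UNIQUE isomorphism `Ψ^ι_env ⥲ Ψ_ξ` whose underlying map
  IS the restriction (`exists_restrictionIso`, `restrictionIso_unique`,
  `exists_unique_restrictionIso_thetaMonoid`); `μ_{2l}`-translates of `θ` change `ξ` but not `Ψ_{2l·ξ}`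
  (`gaussianMonoid2l_eq_of_torsion_translate`).
* **Cor 3.5 (i)/(iii), Cor 3.6 (i)** (constants, diagonal, Frobenioid-theoretic copies): label-independent
  restriction carries `Ψ_cns` isomorphically into the diagonal (`map_le_diagonal_of_labelIndependent`,
  `exists_diagonalIso_of_injOn`); the labelwise Kummer transport `piIso` (`(Ψ_{†C_v})_t ⥲ Ψ_cns,t`, one
  isomorphism at every label) commutes with every relabeling — the symmetrizing isomorphisms of literal
  copies — and respects (unit) diagonals (`piIso_relabel`, `map_piIso_diagonalSubmonoid`,
  `map_piIso_unitDiagonal`).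

NOT covered (reported, not claimed): the Galois-action clause of 3.5 (ii) / Rmk 3.6.1 (needs the
`G_v`-actions on the cohomology modules, which no landed interface carries) and the inner-automorphism
bookkeeping on `Π_{v▶} ↪ Π_X` of Cor 2.8. Nothing here asserts a disputed claim or takes a side on
[IUTchIII] Cor 3.12; typed ≠ proved ≠ endorsed.
-/

namespace Literature.IUT.HodgeArakelov

namespace BadPrimeGaussianMonoids

open TemperedThetaMonoids

universe u v w

/-! ### 1. Cor 3.5 (i): the `𝔽_l^{⋊±}`-symmetries of the `±`-label classes of cusps -/

section Labels

open Literature.IUT.HodgeTheaters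

variable {S : BadPlaceSetting.{u}} {P : TopGroup.{u}} {T : TemperedCoverings S P} {W : PlusMinusTower T}
  {C : CuspidalInertiaData W} (F : FlTorsorStructure C)

/-- **IUTchII:Cor3.5(i)** (kurims p.94): `Π̂^±_v = Π_X̲(M^Θ_*)^∧` acts TRIVIALLY on `LabCusp^±` — the LABEL-LEVEL
shadow of print's "well-defined up to … an inner automorphism of `Π_X̲(M^Θ_*)` … independent of `|t|`"
(which in print concerns the pair `Π_{v▶} ↷ Ψ_cns`; audit note w4-d020). [cite: Mochizuki2012, Cor 3.5 (i) p.94] -/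
theorem conjAct_eq_self_of_mem_pmHat {g : W.Corhat} (hg : g ∈ W.pmHat)
    (t : LabCuspPM C W.pmHat W.pmHat) : F.conjAct g t = t := by
  apply F.chart.injective
  have h1 : (QuotientGroup.mk g : W.Corhat ⧸ W.pmHat) = 1 := by
    rwa [QuotientGroup.eq_one_iff]
  rw [F.conjAct_chart, h1, map_one, SemidirectProduct.one_left, SemidirectProduct.one_right]
  simp

/-- **IUTchII:Cor3.5(i)** (kurims p.94): the identity fixes every label. [cite: Mochizuki2012, Cor 3.5 (i) p.94] -/
theorem conjAct_one (t : LabCuspPM C W.pmHat W.pmHat) : F.conjAct 1 t = t :=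
  conjAct_eq_self_of_mem_pmHat F (one_mem _) t

/-- **IUTchII:Cor3.5(i)** (kurims p.94): the conjugation action of `Π̂^cor_v` on `LabCusp^±` IS an action
(from the chart formula and the group law of `𝔽_l ⋊ {±1}`); so symmetrizing isomorphisms compose.
[cite: Mochizuki2012, Cor 3.5 (i) p.94] -/
theorem conjAct_mul (g h : W.Corhat) (t : LabCuspPM C W.pmHat W.pmHat) :
    F.conjAct (g * h) t = F.conjAct g (F.conjAct h t) := by
  apply F.chart.injective
  simp only [F.conjAct_chart, QuotientGroup.mk_mul, map_mul, SemidirectProduct.mul_left,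
    SemidirectProduct.mul_right, toAdd_mul, signAct_apply, toAdd_ofAdd, Units.val_mul, Int.cast_mul,
    Units.smul_def, zsmul_eq_mul]
  ring

/-- **IUTchII:Cor3.5(i)** (kurims p.94): two elements induce the same relabeling of `t` iff their
"difference" fixes `t`. [cite: Mochizuki2012, Cor 3.5 (i) p.94] -/
theorem conjAct_eq_conjAct_iff (g g' : W.Corhat) (t : LabCuspPM C W.pmHat W.pmHat) :
    F.conjAct g t = F.conjAct g' t ↔ F.conjAct (g'⁻¹ * g) t = t := by
  constructor
  · intro h
    rw [conjAct_mul F, h, ← conjAct_mul F, inv_mul_cancel, conjAct_one F]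
  · intro h
    have := congrArg (F.conjAct g') h
    rwa [← conjAct_mul F, mul_inv_cancel_left] at this

/-- **IUTchII:Cor3.5(i)** (kurims p.94) "induces isomorphisms between the pairs `G_v(M^Θ_*▶)_t ↷ Ψ_cns(M^Θ_*)_t`
… for distinct `t`": the `𝔽_l^{⋊±}`-symmetry is TRANSITIVE on labels (a lift of `x ↦ x + (t' - t)` carries `t`
to `t'`), so symmetrizing isomorphisms exist between any two labeled copies. [cite: Mochizuki2012, Cor 3.5 (i) p.94] -/
theorem exists_conjAct_eq (t t' : LabCuspPM C W.pmHat W.pmHat) : ∃ g : W.Corhat, F.conjAct g t = t' := by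
  obtain ⟨g, hg⟩ := QuotientGroup.mk_surjective (F.quotIso.symm (FlPM.mk (F.chart t' - F.chart t) 1))
  refine ⟨g, F.chart.injective ?_⟩
  rw [F.conjAct_chart, hg, MulEquiv.apply_symm_apply, FlPM.mk_left, FlPM.mk_right, toAdd_ofAdd]
  simp

/-- **IUTchII:Cor3.5(i)** (kurims p.94) "identifying copies labeled by `t`, `-t` via a suitable symmetrizing
isomorphism": a lift of `-1 ∈ {±1} ⊆ 𝔽_l^{⋊±}` acts on ALL labels by `t ↦ -t`. [cite: Mochizuki2012, Cor 3.5 (i) p.94] -/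
theorem exists_conjAct_neg : ∃ g : W.Corhat, ∀ t : LabCuspPM C W.pmHat W.pmHat,
    F.chart (F.conjAct g t) = -F.chart t := by
  obtain ⟨g, hg⟩ := QuotientGroup.mk_surjective (F.quotIso.symm (FlPM.mk 0 (-1)))
  refine ⟨g, fun t => ?_⟩
  rw [F.conjAct_chart, hg, MulEquiv.apply_symm_apply, FlPM.mk_left, FlPM.mk_right, toAdd_ofAdd]
  simp

/-- **IUTchII:Cor3.5(i)** (kurims p.94), well-definedness: an element of `Π̂^cor_v` FIXES the label `t` iff its
image in `𝔽_l^{⋊±} ≅ Π̂^cor_v/Π̂^±_v` is the identity or the reflection `x ↦ -x + 2t`; so a symmetrizing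
isomorphism onto the copy labeled `t` is determined up to `Π̂^±_v` and this one reflection (for `t = 0`: the
symmetry `t ↦ -t`). [cite: Mochizuki2012, Cor 3.5 (i) p.94] -/
theorem conjAct_eq_self_iff (g : W.Corhat) (t : LabCuspPM C W.pmHat W.pmHat) :
    F.conjAct g t = t ↔
      F.quotIso (QuotientGroup.mk g) = 1 ∨
        F.quotIso (QuotientGroup.mk g) = FlPM.mk (2 * F.chart t) (-1) := by
  rw [← F.chart.injective.eq_iff, F.conjAct_chart]
  generalize F.quotIso (QuotientGroup.mk g) = x
  obtain ⟨a, ε⟩ := x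
  simp only [SemidirectProduct.ext_iff, SemidirectProduct.one_left, SemidirectProduct.one_right,
    FlPM.mk_left, FlPM.mk_right]
  rcases Int.units_eq_one_or ε with rfl | rfl
  · simp only [Units.val_one, Int.cast_one, one_mul, add_eq_right, toAdd_eq_zero, and_true,
      (by decide : (1 : ℤˣ) ≠ -1), and_false, or_false]
  · simp only [Units.val_neg, Units.val_one, Int.cast_neg, Int.cast_one, neg_one_mul,
      (by decide : (-1 : ℤˣ) ≠ 1), and_false, false_or, and_true]
    rw [← Multiplicative.toAdd.injective.eq_iff, toAdd_ofAdd]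
    constructor
    · intro h; linear_combination h
    · intro h; linear_combination h

end Labels

/-! ### 2. An isomorphism onto the image from injectivity on a submonoid (bookkeeping) -/

section OntoImage

variable {A : Type u} {B : Type v} [CommMonoid A] [CommMonoid B]

/-- A monoid morphism injective on a submonoid `S` induces an isomorphism `S ⥲ f(S)` with underlying map `f`
(shape of "the bottom horizontal arrow is an isomorphism of monoids", [IUTchII] Cor 3.5). [folklore] -/
private theorem exists_mulEquiv_map_of_injOn (f : A →* B) (S : Submonoid A) (hf : Set.InjOn f S) :
    ∃ e : S ≃* S.map f, ∀ x : S, ((e x : S.map f) : B) = f x := by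
  have hinj : Function.Injective (f.submonoidMap S) := fun ⟨x, hx⟩ ⟨y, hy⟩ h =>
    Subtype.ext (hf hx hy (congrArg Subtype.val h))
  exact ⟨MulEquiv.ofBijective (f.submonoidMap S) ⟨hinj, f.submonoidMap_surjective S⟩, fun x => rfl⟩

/-- Such an isomorphism is unique (it is pinned by its underlying map). [folklore] -/
private theorem mulEquiv_eq_of_coe_eq {S : Submonoid A} {S' : Submonoid B} (f : A → B) (e e' : S ≃* S')
    (he : ∀ x : S, ((e x : S') : B) = f x) (he' : ∀ x : S, ((e' x : S') : B) = f x) : e = e' :=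
  MulEquiv.ext fun x => Subtype.ext ((he x).trans (he' x).symm)

end OntoImage

/-! ### 3. Cor 3.5 (i)/(ii): restriction of `Ψ^ι_env = M^×_TM · θ^ℕ` onto the Gaussian monoid `Ψ_ξ` -/

section Restriction

variable {H : Type u} [CommGroup H] {T : Type v} {M : Type w} [CommMonoid M]

/-- **IUTchII:Cor3.5(ii)** (kurims p.94–95) restriction, inclusion: if the units `M^×_TM` restrict to DIAGONAL
unit families ("`Ψ_cns ⥲ Ψ_cns,⟨|F_l|⟩`", Cor 3.5 (i)), the product of the restriction morphisms carries
`M^×_TM · θ^ℕ` into the Gaussian monoid `Ψ_ξ = Ψ^×_{⟨F_l^⋇⟩} · ξ^ℕ` of the value-profile `ξ := (r_t θ)_t`.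
[cite: Mochizuki2012, Cor 3.5 (ii) p.94] -/
theorem map_thetaSplit_le_gaussianMonoid (U : Subgroup H) (θ : H) (r : T → (H →* M))
    (hU : ∀ u ∈ U, ∃ m : Mˣ, ∀ t, r t u = m) :
    (splitMonoid U (Submonoid.powers θ)).map (MonoidHom.pi r) ≤ gaussianMonoid (fun t => r t θ) := by
  rintro _ ⟨x, hx, rfl⟩
  obtain ⟨u, hu, s, ⟨n, rfl⟩, rfl⟩ := (mem_splitMonoid_iff _ _ _).mp hx
  obtain ⟨m, hm⟩ := hU u hu
  rw [mem_gaussianMonoid_iff]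
  refine ⟨m, n, funext fun t => ?_⟩
  simp only [MonoidHom.pi_apply, map_mul, map_pow, Pi.mul_apply, Pi.pow_apply, hm t]

/-- **IUTchII:Cor3.5(ii)** (kurims p.94–95) restriction, image: if moreover every diagonal unit family is the
restriction of a unit (in print `Ψ^×_cns = M^×_TM`), the image of `M^×_TM · θ^ℕ` IS `Ψ_ξ`.
[cite: Mochizuki2012, Cor 3.5 (ii) p.94] -/
theorem map_thetaSplit_eq_gaussianMonoid (U : Subgroup H) (θ : H) (r : T → (H →* M))
    (hU : ∀ u ∈ U, ∃ m : Mˣ, ∀ t, r t u = m) (hUsurj : ∀ m : Mˣ, ∃ u ∈ U, ∀ t, r t u = m) :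
    (splitMonoid U (Submonoid.powers θ)).map (MonoidHom.pi r) = gaussianMonoid (fun t => r t θ) := by
  refine le_antisymm (map_thetaSplit_le_gaussianMonoid U θ r hU) ?_
  intro x hx
  obtain ⟨m, n, rfl⟩ := (mem_gaussianMonoid_iff _ _).mp hx
  obtain ⟨u, hu, hm⟩ := hUsurj m
  refine ⟨u * θ ^ n, (mem_splitMonoid_iff _ _ _).mpr ⟨u, hu, θ ^ n, ⟨n, rfl⟩, rfl⟩, funext fun t => ?_⟩
  simp only [MonoidHom.pi_apply, map_mul, map_pow, Pi.mul_apply, Pi.pow_apply, hm t]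

/-- **IUTchII:Cor3.5(ii)** (kurims p.95) `∞`-version: if every element of `∞θ^ι_env` is a root of a power of `θ`
("the `N`-th roots … that arise by restricting elements of `∞θ^ι_env`"), restriction carries
`M^×_TM · ∞θ^ℕ` into `∞Ψ_ξ = Ψ^×_{⟨F_l^⋇⟩} · ξ^{ℚ≥0}`. [cite: Mochizuki2012, Cor 3.5 (ii) p.95] -/
theorem map_inftySplit_le_inftyGaussianMonoid (U : Subgroup H) (θ : H) (Θ : Set H) (r : T → (H →* M))
    (hU : ∀ u ∈ U, ∃ m : Mˣ, ∀ t, r t u = m)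
    (hroot : ∀ x ∈ Θ, ∃ a b : ℕ, 0 < a ∧ 0 < b ∧ x ^ a = θ ^ b) :
    (splitMonoid U (Submonoid.closure Θ)).map (MonoidHom.pi r) ≤
      inftyGaussianMonoid (fun t => r t θ) := by
  rw [Submonoid.map_le_iff_le_comap]
  refine sup_le ?_ ?_
  · intro u hu
    obtain ⟨m, hm⟩ := hU u hu
    refine Submonoid.mem_comap.mpr (Submonoid.mem_sup_left ⟨m, funext fun t => ?_⟩)
    simp only [MonoidHom.pi_apply, hm t]
  · rw [Submonoid.closure_le]
    intro x hx
    obtain ⟨a, b, ha, hb, hab⟩ := hroot x hx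
    refine Submonoid.mem_comap.mpr (Submonoid.mem_sup_right (Submonoid.subset_closure ?_))
    refine ⟨a, b, ha, hb, funext fun t => ?_⟩
    rw [Pi.pow_apply, Pi.pow_apply, MonoidHom.pi_apply, ← map_pow, ← map_pow, hab]

/-- **IUTchII:Cor3.5(ii)** (kurims p.95) bookkeeping: the product of the restriction morphisms is injective on
`Ψ^ι_env` as soon as the restriction at ONE label is. [cite: Mochizuki2012, Cor 3.5 (ii) p.95] -/
theorem injOn_pi_of_injOn {A : Type u} [CommMonoid A] (S : Submonoid A) (r : T → (A →* M)) (t₀ : T)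
    (h : Set.InjOn (r t₀) S) : Set.InjOn (MonoidHom.pi r) S := fun x hx y hy hxy =>
  h hx hy (by simpa only [MonoidHom.pi_apply] using congrFun hxy t₀)

/-- **IUTchII:Cor3.5(ii)** (kurims p.95): injectivity of the restriction at one label on `M^×_TM · θ^ℕ` from a
kernel condition — no relation `r(u · θ^k) = 1` with `u ∈ M^×_TM` other than `k = 0, u = 1` (in print: the
theta value `q_v^{t²}` has positive valuation, units restrict injectively). [cite: Mochizuki2012, Cor 3.5 (ii) p.95] -/
theorem injOn_thetaSplit_of_ker (U : Subgroup H) (θ : H) (ρ : H →* M)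
    (hker : ∀ u ∈ U, ∀ k : ℤ, ρ (u * θ ^ k) = 1 → k = 0 ∧ u = 1) :
    Set.InjOn ρ (splitMonoid U (Submonoid.powers θ)) := by
  intro x hx y hy hxy
  obtain ⟨u, hu, _, ⟨n, rfl⟩, rfl⟩ := (mem_splitMonoid_iff _ _ _).mp hx
  obtain ⟨u', hu', _, ⟨m, rfl⟩, rfl⟩ := (mem_splitMonoid_iff _ _ _).mp hy
  have hunit : IsUnit (ρ (u' * θ ^ m)) := (Group.isUnit _).map ρ
  have h1 : ρ ((u * θ ^ n) * (u' * θ ^ m)⁻¹) = 1 := by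
    rw [← hunit.mul_left_inj, ← map_mul, inv_mul_cancel_right, one_mul, hxy]
  have h2 : (u * θ ^ n) * (u' * θ ^ m)⁻¹ = (u * u'⁻¹) * θ ^ ((n : ℤ) - m) := by
    rw [zpow_sub, zpow_natCast, zpow_natCast, mul_inv]
    ac_rfl
  rw [h2] at h1
  obtain ⟨hk, huu⟩ := hker (u * u'⁻¹) (U.mul_mem hu (U.inv_mem hu')) _ h1
  have hnm : n = m := by omega
  rw [mul_inv_eq_one] at huu
  rw [huu, hnm]

/-- **IUTchII:Cor3.5(ii)** (kurims p.95) "the lower … horizontal arrow [`Ψ^ι_env ⥲ Ψ_ξ`] is an isomorphism of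
monoids": an isomorphism `M^×_TM · θ^ℕ ⥲ Ψ_ξ` whose underlying map IS the restriction `x ↦ (r_t x)_t` (pinned,
not a bare existence claim). [cite: Mochizuki2012, Cor 3.5 (ii) p.95] -/
theorem exists_restrictionIso (U : Subgroup H) (θ : H) (r : T → (H →* M))
    (hU : ∀ u ∈ U, ∃ m : Mˣ, ∀ t, r t u = m) (hUsurj : ∀ m : Mˣ, ∃ u ∈ U, ∀ t, r t u = m)
    (t₀ : T) (hinj : Set.InjOn (r t₀) (splitMonoid U (Submonoid.powers θ))) :
    ∃ e : splitMonoid U (Submonoid.powers θ) ≃* gaussianMonoid (fun t => r t θ),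
      ∀ x, ((e x : gaussianMonoid (fun t => r t θ)) : T → M) = MonoidHom.pi r x := by
  obtain ⟨e, he⟩ := exists_mulEquiv_map_of_injOn (MonoidHom.pi r) (splitMonoid U (Submonoid.powers θ))
    (injOn_pi_of_injOn _ r t₀ hinj)
  refine ⟨e.trans (MulEquiv.submonoidCongr (map_thetaSplit_eq_gaussianMonoid U θ r hU hUsurj)),
    fun x => ?_⟩
  rw [MulEquiv.trans_apply, ← he x]
  rfl

/-- **IUTchII:Cor3.5(ii)** (kurims p.95): the restriction isomorphism `Ψ^ι_env ⥲ Ψ_ξ` is UNIQUE among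
isomorphisms whose underlying map is the restriction. [cite: Mochizuki2012, Cor 3.5 (ii) p.95] -/
theorem restrictionIso_unique (U : Subgroup H) (θ : H) (r : T → (H →* M))
    (e e' : splitMonoid U (Submonoid.powers θ) ≃* gaussianMonoid (fun t => r t θ))
    (he : ∀ x, ((e x : gaussianMonoid (fun t => r t θ)) : T → M) = MonoidHom.pi r x)
    (he' : ∀ x, ((e' x : gaussianMonoid (fun t => r t θ)) : T → M) = MonoidHom.pi r x) : e = e' :=
  mulEquiv_eq_of_coe_eq _ e e' he he'

/-- **IUTchII:Cor3.5(ii)** (kurims p.95) "compatible … with the equalities `Ψ_{2l·ξ₁}(M^Θ_*) = Ψ_{2l·ξ₂}(M^Θ_*)`":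
value-profiles differing label-wise by `2l`-torsion factors (restrictions of one `μ_{2l}`-orbit `θ^ι_env`, or
along different `D^δ_{t,μ_-}`) have the same `Ψ_{2l·ξ}`. [cite: Mochizuki2012, Cor 3.5 (ii) p.95] -/
theorem gaussianMonoid2l_eq_of_torsion_translate (twoL : ℕ) {ξ ξ' : T → M}
    (h : ∀ t, ∃ z : M, z ^ twoL = 1 ∧ ξ' t = z * ξ t) :
    gaussianMonoid2l twoL ξ' = gaussianMonoid2l twoL ξ := by
  have hpow : ξ' ^ twoL = ξ ^ twoL := by
    funext t
    obtain ⟨z, hz, ht⟩ := h t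
    simp only [Pi.pow_apply, ht, mul_pow, hz, one_mul]
  unfold gaussianMonoid2l
  rw [hpow]

end Restriction

/-! ### 4. The same statements for the typed theta monoids `Ψ^ι_env(M^Θ_*)` of Proposition 3.1 -/

section ThetaEnv

variable {P : Type u} [Group P] (E : TemperedThetaMonoids.ThetaEnvData.{u, v} P) {T : Type w} {M : Type*}
  [CommMonoid M]

/-- **IUTchII:Cor3.5(ii)** (kurims p.94): when `θ^ι_env` is one `M^×_TM`-orbit (its elements differ by classes of
`2l`-th roots of unity), the typed `Ψ^ι_env = M^×_TM · θ^ι_env^ℕ` is `M^×_TM · θ^ℕ` for any `θ ∈ θ^ι_env`.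
[cite: Mochizuki2012, Cor 3.5 (ii) p.94] -/
theorem thetaMonoid_eq_splitMonoid_powers {ι : E.Iota} {θ : E.H} (hθ : θ ∈ E.thetaEnv ι)
    (horb : ∀ θ' ∈ E.thetaEnv ι, ∃ u ∈ E.units, θ' = u * θ) :
    E.thetaMonoid ι = splitMonoid E.units (Submonoid.powers θ) := by
  refine le_antisymm (sup_le le_sup_left ?_) (sup_le le_sup_left ?_)
  · rw [Submonoid.closure_le]
    intro θ' hθ'
    obtain ⟨u, hu, rfl⟩ := horb θ' hθ'
    exact Submonoid.mul_mem _ (Submonoid.mem_sup_left hu)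
      (Submonoid.mem_sup_right (Submonoid.mem_powers θ))
  · exact le_trans ((Submonoid.powers_le).mpr (Submonoid.subset_closure hθ)) le_sup_right

/-- **IUTchII:Cor3.5(ii)** (kurims p.95) for the typed `Ψ^ι_env(M^Θ_*)`: "the restriction operations … determine …
`Ψ^ι_env(M^Θ_*) ⥲ Ψ_ξ(M^Θ_*)` … isomorphisms of monoids" — a UNIQUE isomorphism onto `Ψ_ξ`, `ξ = (r_t θ)_t`,
whose underlying map is the restriction (hypotheses of §3). [cite: Mochizuki2012, Cor 3.5 (ii) p.95] -/
theorem exists_unique_restrictionIso_thetaMonoid {ι : E.Iota} {θ : E.H} (hθ : θ ∈ E.thetaEnv ι)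
    (horb : ∀ θ' ∈ E.thetaEnv ι, ∃ u ∈ E.units, θ' = u * θ) (r : T → (E.H →* M))
    (hU : ∀ u ∈ E.units, ∃ m : Mˣ, ∀ t, r t u = m) (hUsurj : ∀ m : Mˣ, ∃ u ∈ E.units, ∀ t, r t u = m)
    (t₀ : T) (hinj : Set.InjOn (r t₀) (E.thetaMonoid ι)) :
    ∃! e : E.thetaMonoid ι ≃* gaussianMonoid (fun t => r t θ),
      ∀ x, ((e x : gaussianMonoid (fun t => r t θ)) : T → M) = MonoidHom.pi r x := by
  have hS := thetaMonoid_eq_splitMonoid_powers E hθ horb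
  rw [hS] at hinj
  obtain ⟨e, he⟩ := exists_restrictionIso E.units θ r hU hUsurj t₀ hinj
  refine ⟨(MulEquiv.submonoidCongr hS).trans e, fun x => ?_, fun e' he' => ?_⟩
  · rw [MulEquiv.trans_apply, he]
    rfl
  · refine mulEquiv_eq_of_coe_eq (MonoidHom.pi r) e' _ he' fun x => ?_
    rw [MulEquiv.trans_apply, he]
    rfl

/-- **IUTchII:Cor3.5(ii)** (kurims p.95) for the typed `∞Ψ^ι_env(M^Θ_*)`: restriction carries `∞Ψ^ι_env` into
`∞Ψ_ξ` (inclusion only: the typed `ξ^{ℚ≥0}` over-approximates print, cf. `rootPowers`).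
[cite: Mochizuki2012, Cor 3.5 (ii) p.95] -/
theorem map_inftyThetaMonoid_le {ι : E.Iota} (θ : E.H) (r : T → (E.H →* M))
    (hU : ∀ u ∈ E.units, ∃ m : Mˣ, ∀ t, r t u = m)
    (hroot : ∀ x ∈ E.inftyThetaEnv ι, ∃ a b : ℕ, 0 < a ∧ 0 < b ∧ x ^ a = θ ^ b) :
    (E.inftyThetaMonoid ι).map (MonoidHom.pi r) ≤ inftyGaussianMonoid (fun t => r t θ) :=
  map_inftySplit_le_inftyGaussianMonoid E.units θ _ r hU hroot

end ThetaEnv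

/-! ### 5. Cor 3.5 (i)/(iii), Cor 3.6 (i): constants, the diagonal, and the labeled Kummer copies -/

section Diagonal

variable {H : Type u} [CommMonoid H] {T : Type v} {M : Type w} [CommMonoid M] {N : Type u} [CommMonoid N]

/-- **IUTchII:Cor3.5(i)** (kurims p.94) "`Ψ_cns(M^Θ_*) ⥲ Ψ_cns(M^Θ_*)_{⟨|F_l|⟩}`": restriction morphisms that
agree on the constant monoid carry it into the DIAGONAL submonoid of the product of the labeled copies.
[cite: Mochizuki2012, Cor 3.5 (i) p.94] -/
theorem map_le_diagonal_of_labelIndependent (Ccns : Submonoid H) (r : T → (H →* M))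
    (hC : ∀ x ∈ Ccns, ∀ t t', r t x = r t' x) :
    Ccns.map (MonoidHom.pi r) ≤ diagonalSubmonoid T M := by
  rintro _ ⟨x, hx, rfl⟩ t t'
  simpa only [MonoidHom.pi_apply] using hC x hx t t'

/-- **IUTchII:Cor3.5(i)** (kurims p.94) "the bottom horizontal arrow [`Ψ_cns ⥲ Ψ_cns,⟨|F_l|⟩`] is an isomorphism
of monoids": given injectivity at one label, restriction is an isomorphism of `Ψ_cns` onto its (diagonal)
image, pinned by its underlying map. [cite: Mochizuki2012, Cor 3.5 (i) p.94] -/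
theorem exists_diagonalIso_of_injOn (Ccns : Submonoid H) (r : T → (H →* M)) (t₀ : T)
    (hinj : Set.InjOn (r t₀) Ccns) :
    ∃ e : Ccns ≃* Ccns.map (MonoidHom.pi r), ∀ x : Ccns,
      ((e x : Ccns.map (MonoidHom.pi r)) : T → M) = MonoidHom.pi r x :=
  exists_mulEquiv_map_of_injOn _ _ (injOn_pi_of_injOn Ccns r t₀ hinj)

/-- **IUTchII:Cor3.6(i)** (kurims p.99) "compatible morphisms `(Ψ_{†C_v})_t ⥲ Ψ_cns(M^Θ_*)_t` … independent of `t`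
… as well as … symmetrizing isomorphisms … between the data indexed by distinct `t`": the labeled copies of ONE
Kummer isomorphism (`piIso`) commute with every relabeling of the copies. [cite: Mochizuki2012, Cor 3.6 (i) p.99] -/
theorem piIso_relabel {T' : Type v} (e : N ≃* M) (σ : T' → T) (x : T → N) :
    piIso T' e (x ∘ σ) = piIso T e x ∘ σ := rfl

/-- **IUTchII:Cor3.6(i)** / **Cor3.6(iii)** (kurims pp.99–100): the labeled Kummer copies carry the diagonal
`(Ψ_{†C_v})_{⟨·⟩}` onto the diagonal `Ψ_cns,⟨·⟩` ("compatible with the respective labeled … actions" at the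
level of the underlying monoids). [cite: Mochizuki2012, Cor 3.6 (iii) p.100] -/
theorem map_piIso_diagonalSubmonoid (e : N ≃* M) :
    (diagonalSubmonoid T N).map (piIso T e).toMonoidHom = diagonalSubmonoid T M := by
  ext x
  refine ⟨?_, fun hx => ⟨fun t => e.symm (x t), fun t t' => by simp only [hx t t'], funext fun t => ?_⟩⟩
  · rintro ⟨y, hy, rfl⟩ t t'
    exact congrArg e (hy t t')
  · exact e.apply_symm_apply (x t)

/-- **IUTchII:Cor3.6(iii)** (kurims p.100) "`Ψ_{F_ξ}(†F_v) = (Ψ^×_{†C_v})_{⟨F_l^⋇⟩} · Im(ξ)^ℕ`", unit part: the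
labeled Kummer copies carry the unit diagonal onto the unit diagonal. [cite: Mochizuki2012, Cor 3.6 (iii) p.100] -/
theorem map_piIso_unitDiagonal (e : N ≃* M) :
    (unitDiagonal T N).map (piIso T e).toMonoidHom = unitDiagonal T M := by
  ext x
  rw [Submonoid.mem_map, mem_unitDiagonal]
  refine ⟨?_, fun ⟨u, hu⟩ => ⟨fun _ => (Units.map e.symm.toMonoidHom u : N),
    ⟨Units.map e.symm.toMonoidHom u, rfl⟩, hu ▸ funext fun t => e.apply_symm_apply _⟩⟩
  rintro ⟨y, ⟨u, rfl⟩, rfl⟩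
  exact ⟨Units.map e.toMonoidHom u, funext fun t => rfl⟩

end Diagonal

end BadPrimeGaussianMonoids

end Literature.IUT.HodgeArakelov
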